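import Summits.BirchSwinnertonDyer.BirchSwinnertonDyer.Theorems.ByReductionTypeAtTwoAdditivePotGoodPrintZhaiIrreducibleCorrected
import Summits.BirchSwinnertonDyer.BirchSwinnertonDyer.Theorems.ByReductionTypeAtTwoAdditivePotGoodLowerHalfFrontierRows
import Summits.BirchSwinnertonDyer.BirchSwinnertonDyer.Theorems.EisensteinDepletionAtTwoDepletedLawCFLowerHalf
import Summits.BirchSwinnertonDyer.Rank1Residual.AdditivePotMult.RankZeroKimNakamuraIntModel
import Literature.NumberTheory.DiophantineGeometry.EllArithGlueProofs
import Literature.NumberTheory.DiophantineGeometry.MinimalDiscriminantFiniteProofs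
import Summits.BirchSwinnertonDyer.Uniform.U2.CubicFieldInertOddTrace
import Summits.BirchSwinnertonDyer.Rank1Residual.Supersingular.RationalLadder
import HarnessLib

/-!
# K4 crux `AdditiveRankZeroAtTwo` (19098), child C3″ `AdditivePotGoodLowerHalfAtTwo` (22617): the ZHAI 2016 print road at the bases
# `196B1` (Thm. 1.2, `Δ > 0`) of Cremona's Table 1 — file C (the curve `[0,0,0,−169,845]` = `676D1`, also eligible, is already in the tree as
# `AdditiveBranchIMCGordTwoRankZeroCompanion.cV16900q1` and is left out to keep this file's import cone small)

Cell `bsd-2adic`, seat `bsd-2adic-k4-w2` GEN 6 (prover, explicit unit, no kit); `--supports stmt-BirchSwinnertonDyer-22617 --as helper`;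
companion of `…AdditivePotGoodPrintZhaiIrreducible.lean` (the generic road `printFamilyZhai11_lower` / `printFamilyZhai12_lower`).
HONEST FRAMING (D-0036/D-0054): for each base `V` the KERNEL decides ellipticity, global minimality (Kraus–Silverman certificate), the sign
of `Δ`, `V[2]` irreducible (root-free `2`-division cubic modulo a small prime), `ord₂ j(V)` exactly (inside the window `[1, 11]`: `V` and all
its twists by `M ≡ 1 (mod 4)` are ADDITIVE and POTENTIALLY GOOD at `2`) and non-CM; DISPLAYED, exactly as Zhai's theorem takes them, are the
`X₀(N)`-optimality datum (`Dt`, `hopt` — the bases are the FIRST curves of their classes in Cremona's 1992 Table 1, i.e. the «strong Weil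
curves») and the record `ord₂(L(V,1)/Ω_∞(V)) = 0` (resp. `= 1` for `Δ > 0`), read off Cremona's Tables 1 and 4 (`r = 0`, `S = 1` for every
`N ≤ 1000` except `571A, 681B, 960D, 960N`; `L(V,1)/Ω_BSD = S·∏c_p/#T²` odd; `Ω_BSD = c_∞·Ω_∞`). The road is keyed on Zhai's CORRECTED
statements (arXiv v2: odd Manin constant; the tree's primed facts `Zhai2016.thm11_…'` / `thm12_…'`, ERRATUM file of the b2b cell), the
Manin binder supplied BY PRINT (Agashe–Ribet–Stein 2006 Thm. 2.6, `h26`) from the KERNEL level bound `N(V) ≤ 130000`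
(`N ∣ |Δ_min|`; for `196B1` sharpened by `f₇ ≤ 2`). Labels are those of the 1992 first
edition (held text `book:cremona1997-…`, Table 1 pp. for `N = 104, 116, 124, 196, 200, 540, 676`); the curves are pinned by their
a-invariants. OUTPUT per base: at EVERY global minimal `W ≅ V^{(M)}` (`M` as in Zhai's Thm. 1.1 / 1.2) the C3″ binders are decided
(`r_an(W) = 0`, `Addv W 2`, `0 ≤ ord₂ j`, `¬CM`, `Irr W 2`) and the LOWER half `MissingLowerBoundAt W 2` HOLDS. Inputs BY NAME: Zhai 2016
Thm. 1.1 / 1.2 CORRECTED (flag-free at `2`, analytic rank zero), Agashe–Ribet–Stein Thm. 2.6, modularity. NO GZK, no reading, no instrument, no base certificate. These are the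
first intrinsically-additive `E[2]`-IRREDUCIBLE print families of the K4 additive block (GEN 5's was the `C₂`-type `37a1^{(−m)}`);
disjoint from the cell's residual census (`ord₂ #Ш_an ≤ 0` here). Closes nothing at the `∀`-level; nothing booked; BSD is not proved by
any of this. References: [Zhai2016] Thms. 1.1–1.2; [CremonaAlgorithms1997] Tables 1, 4; [SilvermanAEC2009] III.1, III.2.3, VII.1, VII.5,
App. C §11; [Kraus1989] Prop. 1–2; [Miller2011LMS] Def. 1.1.
-/

set_option autoImplicit false
-- the Theorems namespace of this sub repeats the summit name by design (D-0017 nested layout)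
set_option linter.dupNamespace false

noncomputable section

open scoped Classical

open WeierstrassCurve Literature.NumberTheory.EllipticCurves
  Literature.NumberTheory.EllipticCurves.ModularForms
  Literature.NumberTheory.EllipticCurves.Rank1Residual
  Literature.NumberTheory.EllipticCurves.Rank1Residual.Typed
  Literature.NumberTheory.EllipticCurves.CoatesLiTianZhai2015
  Literature.NumberTheory.EllipticCurves.Zhai2016
  Literature.NumberTheory.EllipticCurves.AgasheRibetStein2006
  Summit.BirchSwinnertonDyer
  Summit.BirchSwinnertonDyer.Rank1Residual
  Summit.BirchSwinnertonDyer.Rank1Residual.X11b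
  Summit.BirchSwinnertonDyer.Rank1Residual.X5.O1
  Summit.BirchSwinnertonDyer.Rank1Residual.P2
  Summit.BirchSwinnertonDyer.BirchSwinnertonDyer.Rank1Residual.IntModel
  Summit.BirchSwinnertonDyer.BirchSwinnertonDyer.Theorems

namespace Summit.BirchSwinnertonDyer.BirchSwinnertonDyer.Theorems.AddPotGoodPrint

/-! ## Base `196B1` = `[0, 1, 0, -114, -127]` (Cremona 1992 Table 1: `N = 196 = 2²·7²`, `r = 0`, `#T = 3`, `c_p = (3, 3)`, Kodaira `IV, IV*`;
Table 4: `S = 1`), `Δ = 92236816` (+), `j = 1792` (`ord₂ j = 8`), Zhai Thm. 1.2 -/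
section Base196B1

/-- `196B1 = [0, 1, 0, -114, -127]` is an elliptic curve (`Δ = 92236816 ≠ 0`). [cite: CremonaAlgorithms1997, Table 1] -/
theorem isElliptic_196B1 : (⟨0, 1, 0, -114, -127⟩ : WeierstrassCurve ℚ).IsElliptic := ⟨by
  rw [isUnit_iff_ne_zero]; norm_num [WeierstrassCurve.Δ, WeierstrassCurve.b₂, WeierstrassCurve.b₄, WeierstrassCurve.b₆, WeierstrassCurve.b₈]⟩

/-- `196B1` is GLOBALLY MINIMAL (`|Δ| = 92236816`: `v_p Δ < 12` at every prime; Kraus at `2`, Silverman at odd `p`).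
[cite: SilvermanAEC2009, VII.1 Remark 1.1] [cite: Kraus1989, Prop. 1 and Prop. 2] -/
theorem isGloballyMinimal_196B1 : (⟨0, 1, 0, -114, -127⟩ : WeierstrassCurve ℚ).IsGloballyMinimal :=
  isGloballyMinimal_of_krausCriterion_support (0) (1) (0) (-114) (-127) [(2, 0, 4), (7, 0, 8)]
    (by intro t ht; simp only [List.mem_cons, List.not_mem_nil, or_false] at ht
        rcases ht with rfl | rfl <;> norm_num)
    (by decide +kernel) (by decide +kernel)

/-- `Δ(196B1) = 92236816` on the integer model. [cite: CremonaAlgorithms1997, Table 1] -/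
theorem M196B1_Δ : (⟨0, 1, 0, -114, -127⟩ : WeierstrassCurve ℤ).Δ = 92236816 := by decide +kernel
/-- `c₄(196B1) = 5488` on the integer model. [cite: CremonaAlgorithms1997, Table 1] -/
theorem M196B1_c₄ : (⟨0, 1, 0, -114, -127⟩ : WeierstrassCurve ℤ).c₄ = 5488 := by decide +kernel
/-- `Δ(196B1) > 0` (rational model). [cite: CremonaAlgorithms1997, Table 1] -/
theorem Δ_sign_196B1 : 0 < (⟨0, 1, 0, -114, -127⟩ : WeierstrassCurve ℚ).Δ := by
  norm_num [WeierstrassCurve.Δ, WeierstrassCurve.b₂, WeierstrassCurve.b₄, WeierstrassCurve.b₆, WeierstrassCurve.b₈]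

/-- The integer model of `196B1` is Cremona's. [cite: SilvermanAEC2009, VIII.8] -/
theorem intModel_196B1 :
    haveI := isElliptic_196B1; haveI := isGloballyMinimal_196B1
    integralModelInt (⟨0, 1, 0, -114, -127⟩ : WeierstrassCurve ℚ) = (⟨0, 1, 0, -114, -127⟩ : WeierstrassCurve ℤ) :=
  haveI := isElliptic_196B1; haveI := isGloballyMinimal_196B1
  integralModelInt_eq_of_map_eq _ (by ext <;> simp [WeierstrassCurve.map])

/-- `b₂, b₄, b₆` of `196B1`. [cite: SilvermanAEC2009, III.1] -/
theorem b_196B1 : (⟨0, 1, 0, -114, -127⟩ : WeierstrassCurve ℚ).b₂ = ((4 : ℤ) : ℚ) ∧ (⟨0, 1, 0, -114, -127⟩ : WeierstrassCurve ℚ).b₄ = ((-228 : ℤ) : ℚ) ∧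
    (⟨0, 1, 0, -114, -127⟩ : WeierstrassCurve ℚ).b₆ = ((-508 : ℤ) : ℚ) := by
  simp only [WeierstrassCurve.b₂, WeierstrassCurve.b₄, WeierstrassCurve.b₆]; norm_num

/-- **`E[2]` irreducible for `196B1`** (`E[2](ℚ) = 0`): the monic `2`-division cubic `X³ + b₂X² + 8b₄X + 16b₆` has no root
modulo `3`. [cite: SilvermanAEC2009, III.2.3 (b)] [cite: Zhai2016, Thm. 1.1 (hypothesis E[2](ℚ) = 0)] -/
theorem irr_two_196B1 :
    haveI := isElliptic_196B1
    Irr (⟨0, 1, 0, -114, -127⟩ : WeierstrassCurve ℚ) 2 :=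
  haveI := isElliptic_196B1
  irr_two_of_forall_cubic_ne _ b_196B1.1 b_196B1.2.1 b_196B1.2.2 (ℓ := 3) (by decide)

/-- **`ord₂ j(196B1) = 8`** (`2⁴ ∥ c₄ = 5488`, `2^4 ∥ Δ`): inside the window `[1, 11]`, so `196B1` and every twist
`196B1^{(M)}` are ADDITIVE and POTENTIALLY GOOD at `2`. [cite: SilvermanAEC2009, III.1 and VII.5 Prop. 5.5] -/
theorem padicValRat_j_196B1 :
    haveI := isElliptic_196B1
    padicValRat 2 (⟨0, 1, 0, -114, -127⟩ : WeierstrassCurve ℚ).j = 8 := by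
  haveI : Fact (Nat.Prime 2) := ⟨Nat.prime_two⟩
  haveI := isElliptic_196B1; haveI := isGloballyMinimal_196B1
  rw [AdditivePotMult.padicValRat_j_eq_of_intModel intModel_196B1 2 4 4 (by rw [M196B1_c₄]; decide) (by rw [M196B1_c₄]; decide)
    (by rw [M196B1_Δ]; decide) (by rw [M196B1_Δ]; decide)]
  norm_num

/-- **`N(196B1) ∣ |Δ_min| = 92236816`** (the conductor divides the minimal discriminant). [cite: SilvermanAEC2009, VIII.11 and C.16] -/
theorem conductorNorm_dvd_196B1 :
    haveI := isElliptic_196B1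
    (⟨0, 1, 0, -114, -127⟩ : WeierstrassCurve ℚ).conductorNorm ℤ ∣ 92236816 := by
  haveI := isElliptic_196B1; haveI := isGloballyMinimal_196B1
  have hdvd := WeierstrassCurve.conductorNorm_dvd_minimalDiscriminantNorm (⟨0, 1, 0, -114, -127⟩ : WeierstrassCurve ℚ)
    (WeierstrassCurve.finite_setOf_ordMinimalDiscriminant_ne_zero_holds _)
  rw [WeierstrassCurve.minimalDiscriminantNorm_int_eq_natAbs_minimalDiscriminantInt_holds,
    minimalDiscriminantInt_eq intModel_196B1, M196B1_Δ] at hdvd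
  exact hdvd

/-- **`N(196B1) ≤ 130000`**: `N ∣ |Δ_min| = 2⁴·7^8` and `f_7 ≤ 2` (the conductor is tame at `7 ≥ 5`, the tree's
`DepletionAtTwo.factorization_conductorNorm_le_two_of_five_le`), so `N ∣ 2⁴·7² = 784` (Cremona: `N = 196`, not needed).
[cite: Silverman1994, IV.10.4] [cite: AgasheRibetStein2006, Thm. 2.6] -/
theorem conductorNorm_le_196B1 :
    haveI := isElliptic_196B1
    (⟨0, 1, 0, -114, -127⟩ : WeierstrassCurve ℚ).conductorNorm ℤ ≤ 130000 := by
  haveI := isElliptic_196B1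
  set N := (⟨0, 1, 0, -114, -127⟩ : WeierstrassCurve ℚ).conductorNorm ℤ with hN
  have hN0 : N ≠ 0 := (conductorNorm_pos_holds _).ne'
  have hle := (Nat.factorization_le_iff_dvd hN0 (by norm_num : (92236816 : ℕ) ≠ 0)).mpr conductorNorm_dvd_196B1
  have hdvd : N ∣ 784 := by
    rw [← Nat.factorization_le_iff_dvd hN0 (by norm_num : (784 : ℕ) ≠ 0)]
    intro q
    by_cases hq : q = 7
    · subst hq
      have h2 : N.factorization 7 ≤ 2 :=
        DepletionAtTwo.factorization_conductorNorm_le_two_of_five_le _ (by norm_num) (by norm_num)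
      have : (784 : ℕ).factorization 7 = 2 := by
        rw [show (784 : ℕ) = 7 ^ 2 * 2 ^ 4 by norm_num, Nat.factorization_mul (by norm_num) (by norm_num),
          Finsupp.add_apply, Nat.Prime.factorization_pow (by norm_num : Nat.Prime 7), Finsupp.single_eq_same,
          Nat.factorization_eq_zero_of_not_dvd (by norm_num)]
      rw [this]; exact h2
    · have hq' := hle q
      have e : (92236816 : ℕ).factorization q = (784 : ℕ).factorization q := by
        rw [show (92236816 : ℕ) = 7 ^ 8 * 2 ^ 4 by norm_num, show (784 : ℕ) = 7 ^ 2 * 2 ^ 4 by norm_num,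
          Nat.factorization_mul (by norm_num) (by norm_num), Nat.factorization_mul (by norm_num) (by norm_num),
          Finsupp.add_apply, Finsupp.add_apply, Nat.Prime.factorization_pow (by norm_num : Nat.Prime 7),
          Nat.Prime.factorization_pow (by norm_num : Nat.Prime 7), Finsupp.single_apply, Finsupp.single_apply,
          if_neg (Ne.symm hq), if_neg (Ne.symm hq)]
      rw [← e]; exact hq'
  exact le_trans (Nat.le_of_dvd (by norm_num) hdvd) (by norm_num)
/-- **`196B1` is non-CM**: `ord₂ j = 8 ∈ {1,2,5,7,8,9,10,11}` (k4-w1's window: no CM `j`-invariant has such a `2`-adic valuation). [cite: SilvermanAEC2009, App. C §11] -/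
theorem not_hasCM_196B1 :
    haveI := isElliptic_196B1
    ¬ (⟨0, 1, 0, -114, -127⟩ : WeierstrassCurve ℚ).HasCM := by
  haveI : Fact (Nat.Prime 2) := ⟨Nat.prime_two⟩
  haveI := isElliptic_196B1; haveI := isGloballyMinimal_196B1
  exact not_hasCM_of_padicValRat_two_j_mem _ (by rw [padicValRat_j_196B1]; decide)

/-- **THE ZHAI-1.2 ROAD AT THE BASE `196B1`**: for every `M` as in Zhai 2016 Thm. 1.2 (`M > 0`, square-free,
`M ≡ 1 (mod 4)`, `(M, N) = 1`, `r ≥ 1` odd prime factors all inert in the cubic `2`-division field `F` of `196B1`) and every global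
minimal `W ≅ 196B1^{(M)}`: `r_an(W) = 0`, `W` is ADDITIVE and POTENTIALLY GOOD at `2`, NON-CM, `W[2]` IRREDUCIBLE, and the LOWER
half `MissingLowerBoundAt W 2` of BSD₂ HOLDS. KERNEL: ellipticity, global minimality, `Δ > 0`, `E[2]` irreducible,
`ord₂ j = 8`, non-CM. DISPLAYED (as printed): the `X₀(196)`-optimality datum (`Dt`, `hopt`) and the record
`ord₂(L(196B1,1)/Ω_∞) = 1` (Cremona 1992 Tables 1 and 4: L(E,1)/Ω_BSD = S·∏c_p/#T² = 9/9 (Δ > 0, two real components, Ω_BSD = 2Ω_∞, so L/Ω_∞ = 2·odd): ord₂ L^alg = 1); the odd Manin constant of Zhai's corrected statement is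
Agashe–Ribet–Stein Thm. 2.6 BY NAME (`h26`) at level `N ≤ 130000` (kernel `conductorNorm_le_196B1`). Inputs BY NAME: Zhai 2016
Thm. 1.2 (corrected, arXiv v2), Agashe–Ribet–Stein 2006 Thm. 2.6, modularity. No GZK, no reading, no instrument, no base
certificate. BSD is not proved by any of this.
[cite: Zhai2016, Thm. 1.2] [cite: AgasheRibetStein2006, Thm. 2.6] [cite: CremonaAlgorithms1997, Table 1 and Table 4] [cite: Miller2011LMS, Def. 1.1] -/
theorem printFamily196B1_lower (h12 : thm12_ordTwo_LAlg_twist_eq_one')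
    (h26 : cremona_abs_maninConstant_eq_one_of_level_le) (hmod : hasEntireLFunction_rat)
    [hN : haveI := isElliptic_196B1; NeZero ((⟨0, 1, 0, -114, -127⟩ : WeierstrassCurve ℚ).conductorNorm ℤ)]
    (Dt : haveI := isElliptic_196B1; ModularParametrizationData (⟨0, 1, 0, -114, -127⟩ : WeierstrassCurve ℚ) ((⟨0, 1, 0, -114, -127⟩ : WeierstrassCurve ℚ).conductorNorm ℤ))
    (hopt : haveI := isElliptic_196B1; Zhai2021.IsOptimalDatum (⟨0, 1, 0, -114, -127⟩ : WeierstrassCurve ℚ) Dt)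
    (hL : haveI := isElliptic_196B1; ∃ x : ℚ, IsLAlg (⟨0, 1, 0, -114, -127⟩ : WeierstrassCurve ℚ) x ∧ x ≠ 0 ∧ padicValRat 2 x = 1)
    (F : Type) [Field F] [NumberField F] (hF : IsTwoDivisionField (⟨0, 1, 0, -114, -127⟩ : WeierstrassCurve ℚ) F)
    (M : ℤ) (hMpos : 0 < M) (hsq : Squarefree M) (hM4 : M % 4 = 1)
    (hgcd : haveI := isElliptic_196B1; Int.gcd M ((⟨0, 1, 0, -114, -127⟩ : WeierstrassCurve ℚ).conductorNorm ℤ) = 1)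
    (hne : M.natAbs.primeFactors.Nonempty) (hin : ∀ q ∈ M.natAbs.primeFactors, q ≠ 2 ∧ IsInertIn F q)
    (W : WeierstrassCurve ℚ) [W.IsElliptic] [W.IsGloballyMinimal]
    (hW : ∃ C : VariableChange ℚ, C • (⟨0, 1, 0, -114, -127⟩ : WeierstrassCurve ℚ).quadraticTwist (M : ℚ) = W) :
    haveI : Fact (Nat.Prime 2) := ⟨Nat.prime_two⟩
    W.analyticRank = 0 ∧ Addv W 2 ∧ 0 ≤ padicValRat 2 W.j ∧ ¬ W.HasCM ∧ Irr W 2 ∧ MissingLowerBoundAt W 2 := by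
  haveI := isElliptic_196B1; haveI := isGloballyMinimal_196B1
  exact printFamilyZhai12'_lower_of_level_le h12 h26 hmod _ conductorNorm_le_196B1 Dt hopt Δ_sign_196B1 irr_two_196B1
    (by rw [padicValRat_j_196B1]; norm_num) (by rw [padicValRat_j_196B1]; norm_num) not_hasCM_196B1 hL F hF M hMpos hsq hM4
    hgcd hne hin W hW

end Base196B1

end Summit.BirchSwinnertonDyer.BirchSwinnertonDyer.Theorems.AddPotGoodPrint

end
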